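import Literature.NumberTheory.EllipticCurves.Kato2004.IwasawaH1ReductionKernel
import Literature.NumberTheory.EllipticCurves.SelmerLevelToPrimary
import HarnessLib

/-!
# `H¹(U, T_pW)` has no `p`-torsion when `W[p]` has no non-zero `U`-fixed point — in particular
# `H¹(Γ_ℚ, T_pW)` is `ℤ_p`-torsion-free when `W(ℚ)[p] = 0` (every elliptic `W/ℚ`, every prime `p`)

Topic `NumberTheory/EllipticCurves`, sub-directory `Kato2004` (namespace = path).  THEOREMS ONLY (no
definition, no named fact, no `sorry`).  The low end of the cohomology sequence of
`0 → T_pW →(p •) T_pW → W[p] → 0`: `ker (p • : H¹(U, T_pW) → H¹(U, T_pW)) = im H⁰(U, W[p])`, so it vanishes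
as soon as `W[p]^U = 0`; proved on continuous cochains with the tree's engine
(`Kato2004/IwasawaH1ReductionKernel`: `TateModule.eq_of_prime_nsmul_eq`,
`TateModule.exists_prime_nsmul_eq_of_proj_one_eq_zero`).  If `p • [φ] = 0` then `p φ = ∂m` for some
`m ∈ T_pW`; reducing modulo `p`, `∂(m mod p) = 0`, so `m mod p ∈ W[p]^U = 0`, `m = p m'`, and
`p (φ − ∂m') = 0` in the `p`-torsion-free `T_pW`, whence `[φ] = [∂m'] = 0`.  Over `Γ_ℚ` the fixed-point
hypothesis is `W(ℚ)[p] = 0` (a `Γ_ℚ`-fixed point of `E(ℚ̄)` is rational,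
`WeierstrassCurve.exists_toGeomPoints_eq_of_forall_smul_eq`), which holds at every prime where `ρ̄_{W,p}`
is irreducible — e.g. at the door primes of the S0 route `DerivedKatoValuationDoor`, whose stub
`stub_rankIntegralH1LeSelmerCorankAtDoor` (crux stmt-BirchSwinnertonDyer-23752) this brick serves.

References: K. Kato, Astérisque 295 (2004), §13.8 (pp. 228–229) and Thm. 12.4 (2) (p. 221: `𝐇¹` has no
`p`-torsion) [Kato2004Asterisque]; J.-P. Serre, *Abelian ℓ-adic representations* (1968), I.1.1 [Serre1968].
-/

noncomputable section

open scoped NumberField Classical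
open Field CategoryTheory
open Literature.NumberTheory.GaloisRepresentations
open Literature.NumberTheory.EllipticCurves Literature.NumberTheory.EllipticCurves.Kato2004
open Literature.NumberTheory.EllipticCurves.Kato2004.EulerSystemValues
open WeierstrassCurve (geomPoints geomTorsion)

namespace Literature.NumberTheory.EllipticCurves.Kato2004

variable (W : WeierstrassCurve ℚ) [W.IsElliptic] (p : ℕ) [Fact p.Prime]
  [ContinuousSMul ℤ_[p] (W.tateModule p)]

/-- **`H¹(U, T_pW)` has no `p`-torsion when `W[p]^U = 0`.**  For a subgroup `U ≤ Γ_ℚ` such that no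
non-zero point of `W[p] = E(ℚ̄)[p]` is fixed by `U`, and `x ∈ H¹(U, T_pW)` with `p • x = 0`, one has `x = 0`
(the low end `H⁰(U, W[p]) → H¹(U, T_pW) →(p •) H¹(U, T_pW)` of the cohomology sequence of
`0 → T_pW → T_pW → W[p] → 0`, on continuous cochains).
[cite: Kato2004Asterisque, §13.8 (pp. 228–229) and Thm. 12.4 (2) (p. 221)] -/
theorem eq_zero_of_prime_smul_eq_zero_of_forall_fixed (U : Subgroup (absoluteGaloisGroup ℚ))
    (hfix : ∀ v : geomPoints W, v ∈ geomTorsion W (p : ℤ) →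
      (∀ g : U, (g : absoluteGaloisGroup ℚ) • v = v) → v = 0)
    (x : H1 (tateRep W p) U) (hx : (p : ℤ_[p]) • x = 0) : x = 0 := by
  obtain ⟨φ, rfl⟩ := oneCocycleClass_surjective _ x
  rw [← oneCocycleClass_smul, oneCocycleClass_eq_zero_iff] at hx
  obtain ⟨m, hm⟩ := hx
  -- the action of `U` on `T_pW|_U` is the Galois action
  have hρ : ∀ (g : U) (a : W.tateModule p),
      (subgroupRep (tateRep W p).toTopRep U).ρ g a = (g : absoluteGaloisGroup ℚ) • a :=
    fun g a => rfl
  -- `p • φ g = g m − m`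
  have hm' : ∀ g : U, p • φ.1 g = (g : absoluteGaloisGroup ℚ) • m - m := fun g => by
    have h := hm g
    rw [Submodule.coe_smul, ContinuousMap.smul_apply, Nat.cast_smul_eq_nsmul, hρ] at h
    exact h
  -- reducing modulo `p`: `m mod p` is `U`-fixed, hence `0`
  have hfixed : ∀ g : U, (g : absoluteGaloisGroup ℚ) • TateModule.proj p 1 m = TateModule.proj p 1 m :=
    fun g => by
    have h := congrArg (TateModule.proj p 1) (hm' g)
    rw [map_nsmul, TateModule.smul_proj_succ, map_sub, TateModule.proj_smul_of_distribMulAction] at h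
    have h0 : TateModule.proj p 0 (φ.1 g) = 0 := by
      have := TateModule.pow_smul_proj 0 (φ.1 g)
      rwa [pow_zero, one_smul] at this
    rw [h0] at h
    exact (sub_eq_zero.mp h.symm)
  have hmem : TateModule.proj p 1 m ∈ geomTorsion W (p : ℤ) := by
    have h := W.proj_tateModule_mem_geomTorsion p 1 m
    rwa [pow_one] at h
  have hproj : TateModule.proj p 1 m = 0 := hfix _ hmem hfixed
  -- `m = p • b`
  obtain ⟨b, hb, -⟩ := TateModule.exists_prime_nsmul_eq_of_proj_one_eq_zero m hproj
  -- `φ = ∂b` since `T_pW` has no `p`-torsion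
  rw [oneCocycleClass_eq_zero_iff]
  refine ⟨b, fun g => ?_⟩
  rw [hρ]
  apply TateModule.eq_of_prime_nsmul_eq
  rw [hm' g, ← hb, nsmul_sub, smul_comm]

/-- **`H¹(Γ_ℚ, T_pW)` is `ℤ_p`-torsion-free when `W(ℚ)[p] = 0`**: a `Γ_ℚ`-fixed point of `E(ℚ̄)[p]`
lies in `E(ℚ̄)[p^∞]^{Γ_ℚ}`, which vanishes (`WeierstrassCurve.geomPrimaryTorsion_eq_zero_of_forall_smul_eq`: it
descends to `W(ℚ)` and `W(ℚ)[p] = ⊥`); so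
`p • x = 0 ⟹ x = 0` in `H¹(⊤, T_pW)` (previous theorem).  Holds at every prime where `ρ̄_{W,p}` is
irreducible (e.g. at the S0 door primes). [cite: Kato2004Asterisque, §13.8 (pp. 228–229) and Thm. 12.4 (2) (p. 221)] -/
theorem eq_zero_of_prime_smul_eq_zero_of_torsionBy_eq_bot
    (hK : AddSubgroup.torsionBy W.toAffine.Point (p : ℤ) = ⊥)
    (x : H1 (tateRep W p) ⊤) (hx : (p : ℤ_[p]) • x = 0) : x = 0 := by
  refine eq_zero_of_prime_smul_eq_zero_of_forall_fixed W p ⊤ ?_ x hx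
  intro v hv hfixv
  -- `v ∈ E(ℚ̄)[p] ⊆ E(ℚ̄)[p^∞]` is `Γ_ℚ`-fixed, hence `0` (`geomPrimaryTorsion_eq_zero_of_forall_smul_eq`)
  have hfixQ : ∀ σ : absoluteGaloisGroup ℚ, σ • v = v := fun σ ↦ hfixv ⟨σ, Subgroup.mem_top σ⟩
  have hpv : p • v = 0 := AddSubgroup.torsionBy.nsmul_iff.mp hv
  have hmem : v ∈ WeierstrassCurve.geomPrimaryTorsion W p :=
    (AddCommGroup.mem_primaryComponent).mpr ⟨1, by rw [pow_one]; exact hpv⟩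
  let a : ↥(WeierstrassCurve.geomPrimaryTorsion W p) := ⟨v, hmem⟩
  have ha : ∀ σ : absoluteGaloisGroup ℚ, σ • a = a := fun σ ↦ by
    apply Subtype.ext
    rw [primaryComponent.coe_smul]
    exact hfixQ σ
  have h0 : a = 0 := by
    refine W.geomPrimaryTorsion_eq_zero_of_forall_smul_eq p ?_ a ha
    -- the `AddCommGroup` structure on `W(ℚ)` is elaborated there with the classical `DecidableEq ℚ`
    -- and here with `Rat`'s; the instances are equal (`Subsingleton`), so `convert` closes the gap
    convert hK using 6
  exact congrArg Subtype.val h0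

/-- **`p^k • x = 0 ⟹ x = 0` in `H¹(Γ_ℚ, T_pW)` when `W(ℚ)[p] = 0`** (iterate the previous theorem).
[cite: Kato2004Asterisque, Thm. 12.4 (2) (p. 221)] -/
theorem eq_zero_of_prime_pow_smul_eq_zero_of_torsionBy_eq_bot
    (hK : AddSubgroup.torsionBy W.toAffine.Point (p : ℤ) = ⊥) (k : ℕ)
    (x : H1 (tateRep W p) ⊤) (hx : ((p : ℤ_[p]) ^ k) • x = 0) : x = 0 := by
  induction k generalizing x with
  | zero => simpa using hx
  | succ k ih =>
    apply ih
    apply eq_zero_of_prime_smul_eq_zero_of_torsionBy_eq_bot W p hK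
    rw [smul_smul, ← pow_succ', hx]

/-- **Cancellation**: `p^k • x = p^k • y ⟹ x = y` in `H¹(Γ_ℚ, T_pW)` when `W(ℚ)[p] = 0`.
[cite: Kato2004Asterisque, Thm. 12.4 (2) (p. 221)] -/
theorem eq_of_prime_pow_smul_eq_of_torsionBy_eq_bot
    (hK : AddSubgroup.torsionBy W.toAffine.Point (p : ℤ) = ⊥) (k : ℕ)
    {x y : H1 (tateRep W p) ⊤} (h : ((p : ℤ_[p]) ^ k) • x = ((p : ℤ_[p]) ^ k) • y) : x = y := by
  rw [← sub_eq_zero]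
  exact eq_zero_of_prime_pow_smul_eq_zero_of_torsionBy_eq_bot W p hK k (x - y) (by rw [smul_sub, h, sub_self])

end Literature.NumberTheory.EllipticCurves.Kato2004

end
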